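import Literature.AlgebraicGeometry.AbelianSchemes.PolarizedAbelianSchemeWithLevelBaseChange
import Literature.AlgebraicGeometry.AbelianSchemes.PolarizedAbelianSchemeWithLevelBaseChangeUnique
import HarnessLib

/-!
# Isomorphism of the pulled-back triples at two points is insensitive to an intermediate base change («TUPLE-ISO ALONG π»)

Topic `AlgebraicGeometry/AbelianSchemes`; namespace `Literature.AlgebraicGeometry.AbelianSchemes.PolarizedAbelianSchemeWithLevel`.  THEOREMS ONLY
(no def, no instance, no notation, no named fact, no `sorry`).  Cell `hodgecm-mathlib` (D-0151), P6 «MOD programme», sub-desk P6a, GEN layer — organ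
(O5′) «TUPLE-ISO ALONG π» (A-p03 (g29), 2026-09-01): the MFK core of the witness transport of the moduli datum՚s fine-moduli injectivity field
`inj₀` (IMAGE-INJ, LEAD M-17f) from the universal tuple `univ := univᵢ ×_{𝓜ᵢ} 𝓨` over the localised restricted model `𝓨` (★ INT-RES, projection
`π : 𝓨 → 𝓜ᵢ`) to the tuple `univᵢ` over the model `𝓜ᵢ` itself, where fine-moduli injectivity lives.  HC_CM is proved only modulo the printed
citations until rung 0 closes; nothing here is about HC.

THE MATHEMATICS ([MumfordFogartyKirwan1994] Ch. 7 §2 Def. 7.2, «`𝒜_{g,d,n}` is a contravariant functor … all up to isomorphism»; [GortzWedhorn2020]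
Prop. 4.16).  Let `P` be a polarised abelian scheme with level structure over `Y`, `P′` one over `Y′`, related by a pull-back relation
`P′ → P` along `π : Y′ → Y` (★ `PolarizedAbelianSchemeWithLevel.IsBaseChangeVia`; e.g. `P′ = P.baseChange π`), and `t₁, t₂ : T → Y′` two points.
Then the pulled-back triples `t₁^*P′`, `t₂^*P′` are ISOMORPHIC (related along `𝟙 T` — MFK՚s isomorphism of triples: group schemes, EXACT
polarisation, EXACT level, Poincaré bundle) iff `(t₁ ≫ π)^*P`, `(t₂ ≫ π)^*P` are: both `tᵢ^*P′` and `(tᵢ ≫ π)^*P` are pull-backs of `P` along the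
SAME map `tᵢ ≫ π` (★ `baseChange_isBaseChangeVia`, ★ `IsBaseChangeVia.trans`), hence isomorphic as triples (★ `IsBaseChangeVia.exists_isBaseChangeVia_id`),
and relations along `𝟙 T` compose (★ `trans`).

MAIN STATEMENTS.  `IsBaseChangeVia.comp_id_id` (compose two relations along `𝟙 T`), **`exists_isBaseChangeVia_id_baseChange_iff_of_isBaseChangeVia`**
(the head, for any relation `P′ → P` along `π`), **`exists_isBaseChangeVia_id_baseChange_baseChange_iff`** (the case `P′ = P.baseChange π`).

## References
* [MumfordFogartyKirwan1994] D. Mumford, J. Fogarty, F. Kirwan, *Geometric Invariant Theory*, 3rd ed. (1994), Ch. 7 §2 Def. 7.2 (p. 129).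
* [GortzWedhorn2020] U. Görtz, T. Wedhorn, *Algebraic Geometry I*, 2nd ed. (2020), Prop. 4.16 (p. 101); Section (4.7) (pp. 107–108).
-/

set_option autoImplicit false

noncomputable section

universe u

open CategoryTheory CategoryTheory.Limits AlgebraicGeometry

namespace Literature.AlgebraicGeometry.AbelianSchemes

namespace PolarizedAbelianSchemeWithLevel

variable {g N : ℕ} {δ : Fin g → ℕ} {Y Y' T : Scheme.{u}}

/-- Relations along `𝟙 T` compose to a relation along `𝟙 T` (★ `IsBaseChangeVia.trans` with `𝟙 ≫ 𝟙 = 𝟙`). [cite: MumfordFogartyKirwan1994, Ch. 7 §2 Definition 7.2 (p. 129)] -/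
theorem IsBaseChangeVia.comp_id_id {P₁ P₂ P₃ : PolarizedAbelianSchemeWithLevel g N δ T}
    {G₃ : P₃.A.X.left ⟶ P₂.A.X.left} {Ĝ₃ : P₃.D.hat.X.left ⟶ P₂.D.hat.X.left}
    {G₂ : P₂.A.X.left ⟶ P₁.A.X.left} {Ĝ₂ : P₂.D.hat.X.left ⟶ P₁.D.hat.X.left}
    (h₃ : P₃.IsBaseChangeVia P₂ (𝟙 T) G₃ Ĝ₃) (h₂ : P₂.IsBaseChangeVia P₁ (𝟙 T) G₂ Ĝ₂) :
    P₃.IsBaseChangeVia P₁ (𝟙 T) (G₃ ≫ G₂) (Ĝ₃ ≫ Ĝ₂) := by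
  have h := h₃.trans h₂
  rwa [Category.comp_id] at h

/-- **TUPLE-ISO ALONG π.**  For a pull-back relation `P′ → P` along `π : Y′ → Y` and two points `t₁ t₂ : T → Y′`, the triples `t₁^*P′` and
`t₂^*P′` are isomorphic (related along `𝟙 T`) iff `(t₁ ≫ π)^*P` and `(t₂ ≫ π)^*P` are. [cite: MumfordFogartyKirwan1994, Ch. 7 §2 Definition 7.2 (p. 129)]
[cite: GortzWedhorn2020, Prop. 4.16 (p. 101) and Section (4.7) (pp. 107–108)] -/
theorem exists_isBaseChangeVia_id_baseChange_iff_of_isBaseChangeVia {P : PolarizedAbelianSchemeWithLevel g N δ Y}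
    {P' : PolarizedAbelianSchemeWithLevel g N δ Y'} {π : Y' ⟶ Y} {G : P'.A.X.left ⟶ P.A.X.left} {Ĝ : P'.D.hat.X.left ⟶ P.D.hat.X.left}
    (h : P'.IsBaseChangeVia P π G Ĝ) (t₁ t₂ : T ⟶ Y') :
    (∃ (H : (P'.baseChange t₁).A.X.left ⟶ (P'.baseChange t₂).A.X.left)
        (Ĥ : (P'.baseChange t₁).D.hat.X.left ⟶ (P'.baseChange t₂).D.hat.X.left),
        (P'.baseChange t₁).IsBaseChangeVia (P'.baseChange t₂) (𝟙 T) H Ĥ) ↔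
      ∃ (H : (P.baseChange (t₁ ≫ π)).A.X.left ⟶ (P.baseChange (t₂ ≫ π)).A.X.left)
        (Ĥ : (P.baseChange (t₁ ≫ π)).D.hat.X.left ⟶ (P.baseChange (t₂ ≫ π)).D.hat.X.left),
        (P.baseChange (t₁ ≫ π)).IsBaseChangeVia (P.baseChange (t₂ ≫ π)) (𝟙 T) H Ĥ := by
  -- the four pull-backs of `P` along `tᵢ ≫ π`
  have h₁' : (P'.baseChange t₁).IsBaseChangeVia P (t₁ ≫ π) _ _ := (P'.baseChange_isBaseChangeVia t₁).trans h
  have h₂' : (P'.baseChange t₂).IsBaseChangeVia P (t₂ ≫ π) _ _ := (P'.baseChange_isBaseChangeVia t₂).trans h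
  have h₁ := P.baseChange_isBaseChangeVia (t₁ ≫ π)
  have h₂ := P.baseChange_isBaseChangeVia (t₂ ≫ π)
  constructor
  · rintro ⟨H, Ĥ, hH⟩
    -- `(t₁π)^*P ≅ t₁^*P′ ≅ t₂^*P′ ≅ (t₂π)^*P`, all along `𝟙 T`
    obtain ⟨H₁, Ĥ₁, e₁⟩ := IsBaseChangeVia.exists_isBaseChangeVia_id h₁' h₁
    obtain ⟨H₂, Ĥ₂, e₂⟩ := IsBaseChangeVia.exists_isBaseChangeVia_id h₂ h₂'
    exact ⟨_, _, (e₁.comp_id_id hH).comp_id_id e₂⟩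
  · rintro ⟨H, Ĥ, hH⟩
    obtain ⟨H₁, Ĥ₁, e₁⟩ := IsBaseChangeVia.exists_isBaseChangeVia_id h₁ h₁'
    obtain ⟨H₂, Ĥ₂, e₂⟩ := IsBaseChangeVia.exists_isBaseChangeVia_id h₂' h₂
    exact ⟨_, _, (e₁.comp_id_id hH).comp_id_id e₂⟩

/-- **The case `P′ = P ×_Y Y′`** (★ `baseChange_isBaseChangeVia`): `t₁^*(π^*P) ≅ t₂^*(π^*P)` as triples iff `(t₁ ≫ π)^*P ≅ (t₂ ≫ π)^*P`.  At the
P6a witness: `Y := 𝓜ᵢ.total`, `Y′ := 𝓨.total`, `π` the projection, `tᵢ := spPt … (red₀ yᵢ)` — fine-moduli injectivity of `𝓜ᵢ` then speaks about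
`tᵢ ≫ π` (★ INT-RES `reductionAt_point_ext` turns their equality back into `red₀ y₁ = red₀ y₂`). [cite: MumfordFogartyKirwan1994, Ch. 7 §2 Definition 7.2 (p. 129)] -/
theorem exists_isBaseChangeVia_id_baseChange_baseChange_iff (P : PolarizedAbelianSchemeWithLevel g N δ Y) (π : Y' ⟶ Y)
    (t₁ t₂ : T ⟶ Y') :
    (∃ (H : ((P.baseChange π).baseChange t₁).A.X.left ⟶ ((P.baseChange π).baseChange t₂).A.X.left)
        (Ĥ : ((P.baseChange π).baseChange t₁).D.hat.X.left ⟶ ((P.baseChange π).baseChange t₂).D.hat.X.left),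
        ((P.baseChange π).baseChange t₁).IsBaseChangeVia ((P.baseChange π).baseChange t₂) (𝟙 T) H Ĥ) ↔
      ∃ (H : (P.baseChange (t₁ ≫ π)).A.X.left ⟶ (P.baseChange (t₂ ≫ π)).A.X.left)
        (Ĥ : (P.baseChange (t₁ ≫ π)).D.hat.X.left ⟶ (P.baseChange (t₂ ≫ π)).D.hat.X.left),
        (P.baseChange (t₁ ≫ π)).IsBaseChangeVia (P.baseChange (t₂ ≫ π)) (𝟙 T) H Ĥ :=
  exists_isBaseChangeVia_id_baseChange_iff_of_isBaseChangeVia (P.baseChange_isBaseChangeVia π) t₁ t₂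

end PolarizedAbelianSchemeWithLevel

end Literature.AlgebraicGeometry.AbelianSchemes

end
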